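import Summits.Ventures.Crystal3D.Theorems.StickyWulffConstantCoaxialWallLawExactTrans
import Summits.Ventures.Crystal3D.Theorems.StickyWulffConstantCoaxialWallLawExactTwin
import Summits.Ventures.Crystal3D.Theorems.StickyWulffConstantCoaxialWallLawUnion
import HarnessLib

/-!
# The union theorem of branch F at `22` ends per payer: `stub_coaxialTwoSlabAdhesion` VERBATIM with `½ ↦ 1/44`
# (E1 rows by name; ×260 over `√2/11440`)

HONEST FRAMING. Part of the venture `Summits/Ventures/Crystal3D` (cell `crystal3d-full`), helper
`--supports` the crux `CoaxialWallLaw` (stmt-Ventures-19481, `route-Ventures-StickyWulffConstant`),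
REGISTERED line `WallLedgerF` (planner cf-p1 gen 16), open stub `stub_coaxialTwoSlabAdhesion`.
RUNG CREDIT ONLY — this is NOT the stub: the constant is `1/44 ≈ 0.0227`, not `½`.  The text of the union theorem
`coaxialTwoSlabAdhesion_smallCharge` (`…Union`, `√2/11440`, kissing facts) with every rung replaced by its EXACTLY
ACCOUNTED version (19481-p1 g6's end accounting `…ExactCount`/`…EndCharge`/`…EndMult`: reachable ends pay at their
own ball, `≤ 22` per unsaturated ball): twins by 19481-p1's `coaxialTwoSlabAdhesion_general_twin_exact` (`√6/88·sin θ`),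
translations by this seat's `…ExactTrans` over the skew-root trichotomy (`…SkewArithmetic`/`…SkewRoots`/`…SkewAxis`):
(A) generic offset ⇒ `1/44` orientation-free; (B) doubly skew axis ⇒ the defender RE-PICKS the axis
(`exists_skewRoot_of_axis_sine`: rise `≥ sin θ'/√2`) ⇒ `(1/44)·sin θ'`; (C) skew plane ⇒ `(√6/88)·sin θ'`.
INPUTS BY NAME: the E1 census rows C12-55 (`hcert`) and the A12 glide star (`hcertA`) — certified-computation
targets of the cell (cf-p2 R39c / P5 family); NO kissing facts.

* `coaxialTwoSlabAdhesion_translate_exact` — translation pairs, `∃` frame, charge `(1/44)·sin θ`;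
* **`coaxialTwoSlabAdhesion_exactCharge`** — the registered stub `CoaxialTwoSlabAdhesion` VERBATIM with
  `(1/2 : ℝ) ↦ (1/44 : ℝ)`, EVERY co-axial pair `Λ₁ ≠ Λ₂`, arbitrary fillings, no residual, h-uniform.
With multiplicity ONE per end (the sharp k-fold-top census) the same texts give `(√6/4)·sin θ` (twins, skew planes),
`½·sin θ` (doubly skew axis) and `½` (generic): the crux's `½` exactly (memo F-UNION §3).

WHAT THIS IS NOT: not the stub (`1/44 < ½`); the crux form is `…ExactCharge`; F-C1 not moved.
-/

noncomputable section

namespace Summit.Ventures.Crystal3D.Theorems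

open Summit.Ventures.Crystal3D Finset NearIdentity
open Literature.MathematicalPhysics.StatisticalMechanics (fccStacking barlowStacking IsHaggSeq constHagg
  isHaggSeq_const contactDeficiency)
open scoped InnerProductSpace

/-- A frame of the same linear lattice carries the moved lattice inside its fcc stacking. -/
theorem movedFcc_subset_frame_of_image_eq
    (A L' : EuclideanSpace ℝ (Fin 3) ≃ₗᵢ[ℝ] EuclideanSpace ℝ (Fin 3)) (t : EuclideanSpace ℝ (Fin 3))
    (h : A '' fccStacking 1 (Real.sqrt (2 / 3)) = L' '' fccStacking 1 (Real.sqrt (2 / 3))) :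
    (fun p => A p + t) '' fccStacking 1 (Real.sqrt (2 / 3)) ⊆
      (fun p => L' p + t) '' barlowStacking 1 (Real.sqrt (2 / 3)) constHagg := by
  rintro _ ⟨q, hq, rfl⟩
  obtain ⟨q', hq', e⟩ : A q ∈ L' '' fccStacking 1 (Real.sqrt (2 / 3)) := by rw [← h]; exact ⟨q, hq, rfl⟩
  exact ⟨q', hq', by simp only [e]⟩

section Exact

variable {s₀ : EuclideanSpace ℝ (Fin 3)} (hs₀ : s₀ ∈ fccSlots)
  (hcert : ExactOnly 0 (fccSlots.filter fun w => 0 < ⟪w, s₀⟫_ℝ))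
  (hcertA : ∀ (A : EuclideanSpace ℝ (Fin 3) ≃ₗᵢ[ℝ] EuclideanSpace ℝ (Fin 3)) (n : EuclideanSpace ℝ (Fin 3)),
    ‖n‖ = 1 → (∀ w ∈ fccSlots, ⟪A w, n⟫_ℝ = 0 ∨ ⟪A w, n⟫_ℝ = Real.sqrt (2 / 3) ∨ ⟪A w, n⟫_ℝ = -Real.sqrt (2 / 3)) →
    ∀ u ∈ fccSlots, ⟪A u, n⟫_ℝ = 0 → ∀ b : EuclideanSpace ℝ (Fin 3),
    ExactOnly b (insert (b - A u)
      (((fccSlots.filter fun s => ⟪s, u⟫_ℝ = -(1 / 2) ∧ ⟪A (u + s), n⟫_ℝ ≤ 0).image (fun s => b + A s)) ∪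
        ((fccSlots.filter fun s => ⟪s, u⟫_ℝ = -(1 / 2) ∧ ⟪A (u + s), n⟫_ℝ < 0).image
          (fun s => b + (A s - (2 * ⟪A s, n⟫_ℝ) • n))))))
include hs₀ hcert hcertA

open scoped Classical in
/-- **The exact union for TRANSLATION pairs** (`A₁·Λ₀ = A₂·Λ₀`, `Λ₁ ≠ Λ₂`): for SOME frame, charge
`(1/44)·sin θ`.  See the module docstring. -/
theorem coaxialTwoSlabAdhesion_translate_exact
    (A₁ : EuclideanSpace ℝ (Fin 3) ≃ₗᵢ[ℝ] EuclideanSpace ℝ (Fin 3)) (t₁ : EuclideanSpace ℝ (Fin 3))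
    (A₂ : EuclideanSpace ℝ (Fin 3) ≃ₗᵢ[ℝ] EuclideanSpace ℝ (Fin 3)) (t₂ : EuclideanSpace ℝ (Fin 3))
    (L : EuclideanSpace ℝ (Fin 3) ≃ₗᵢ[ℝ] EuclideanSpace ℝ (Fin 3)) (s₁ s₂ : EuclideanSpace ℝ (Fin 3))
    (σ σ' : ℤ → ℤ) (hσ : IsHaggSeq σ) (hσ' : IsHaggSeq σ')
    (hsub₁ : (fun p => A₁ p + t₁) '' fccStacking 1 (Real.sqrt (2 / 3)) ⊆
      (fun p => L p + s₁) '' barlowStacking 1 (Real.sqrt (2 / 3)) σ)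
    (hsub₂ : (fun p => A₂ p + t₂) '' fccStacking 1 (Real.sqrt (2 / 3)) ⊆
      (fun p => L p + s₂) '' barlowStacking 1 (Real.sqrt (2 / 3)) σ')
    (htrans : A₁ '' fccStacking 1 (Real.sqrt (2 / 3)) = A₂ '' fccStacking 1 (Real.sqrt (2 / 3)))
    (hne : (fun p => A₁ p + t₁) '' fccStacking 1 (Real.sqrt (2 / 3)) ≠
      (fun p => A₂ p + t₂) '' fccStacking 1 (Real.sqrt (2 / 3))) :
    ∃ (L : EuclideanSpace ℝ (Fin 3) ≃ₗᵢ[ℝ] EuclideanSpace ℝ (Fin 3))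
        (s₁ s₂ : EuclideanSpace ℝ (Fin 3)) (σ σ' : ℤ → ℤ), IsHaggSeq σ ∧ IsHaggSeq σ' ∧
        (fun p => A₁ p + t₁) '' fccStacking 1 (Real.sqrt (2 / 3)) ⊆
          (fun p => L p + s₁) '' barlowStacking 1 (Real.sqrt (2 / 3)) σ ∧
        (fun p => A₂ p + t₂) '' fccStacking 1 (Real.sqrt (2 / 3)) ⊆
          (fun p => L p + s₂) '' barlowStacking 1 (Real.sqrt (2 / 3)) σ' ∧
    ∃ C R₀ : ℝ, 1 ≤ R₀ ∧ ∀ h : ℝ, 0 ≤ h → ∀ ρ : ℝ, R₀ ≤ ρ →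
      ∀ X P₁ P₂ : Finset (EuclideanSpace ℝ (Fin 3)),
      (∀ p ∈ X, ∀ q ∈ X, p ≠ q → 1 ≤ dist p q) → P₁ ⊆ X → P₂ ⊆ X \ P₁ →
      (∀ p ∈ X, -(2 * R₀) ≤ p 2 ∧ p 2 ≤ h + 2 * R₀ ∧ p 0 ^ 2 + p 1 ^ 2 ≤ ρ ^ 2) →
      (∀ p, p ∈ P₁ ↔ (p ∈ (fun q => A₁ q + t₁) '' fccStacking 1 (Real.sqrt (2 / 3)) ∧
        -(2 * R₀) ≤ p 2 ∧ p 2 ≤ -R₀ ∧ p 0 ^ 2 + p 1 ^ 2 ≤ ρ ^ 2)) →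
      (∀ p, p ∈ P₂ ↔ (p ∈ (fun q => A₂ q + t₂) '' fccStacking 1 (Real.sqrt (2 / 3)) ∧
        h + R₀ ≤ p 2 ∧ p 2 ≤ h + 2 * R₀ ∧ p 0 ^ 2 + p 1 ^ 2 ≤ ρ ^ 2)) →
      ((((P₁ ×ˢ (X \ P₁)).filter fun pq => dist pq.1 pq.2 = 1).card : ℕ) : ℝ) +
        ((((P₂ ×ˢ ((X \ P₁) \ P₂)).filter fun pq => dist pq.1 pq.2 = 1).card : ℕ) : ℝ) ≤
        contactDeficiency ((X \ P₁) \ P₂) +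
          (Real.sqrt 2 / 4 * ∑ᶠ w ∈ {w ∈ fccStacking 1 (Real.sqrt (2 / 3)) | ‖w‖ = 1},
              |⟪w, A₁.symm (EuclideanSpace.single (2 : Fin 3) (1 : ℝ))⟫_ℝ| +
            Real.sqrt 2 / 4 * ∑ᶠ w ∈ {w ∈ fccStacking 1 (Real.sqrt (2 / 3)) | ‖w‖ = 1},
              |⟪w, A₂.symm (EuclideanSpace.single (2 : Fin 3) (1 : ℝ))⟫_ℝ| -
            (1 / 44 : ℝ) * Real.sqrt (1 - ⟪L (EuclideanSpace.single (2 : Fin 3) (1 : ℝ)),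
              (EuclideanSpace.single (2 : Fin 3) (1 : ℝ))⟫_ℝ ^ 2)) * Real.pi * ρ ^ 2 +
          C * (1 + h) * ρ := by
  set e₃ : EuclideanSpace ℝ (Fin 3) := EuclideanSpace.single (2 : Fin 3) (1 : ℝ) with he₃
  set τ : EuclideanSpace ℝ (Fin 3) := A₁.symm (t₂ - t₁) with hτ
  have hτΛ : τ ∉ fccStacking 1 (Real.sqrt (2 / 3)) := offset_notMem_of_ne A₁ A₂ t₁ t₂ htrans hne
  have hsin : ∀ M : EuclideanSpace ℝ (Fin 3) ≃ₗᵢ[ℝ] EuclideanSpace ℝ (Fin 3),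
      0 ≤ Real.sqrt (1 - ⟪M e₃, e₃⟫_ℝ ^ 2) ∧ Real.sqrt (1 - ⟪M e₃, e₃⟫_ℝ ^ 2) ≤ 1 := by
    intro M
    refine ⟨Real.sqrt_nonneg _, ?_⟩
    rw [show (1 : ℝ) = Real.sqrt 1 from Real.sqrt_one.symm]
    exact Real.sqrt_le_sqrt (by rw [Real.sqrt_one]; nlinarith [sq_nonneg ⟪M e₃, e₃⟫_ℝ])
  have hπρ : ∀ ρ : ℝ, 0 ≤ Real.pi * ρ ^ 2 := fun ρ => by positivity
  have hΛ₂ : A₂ '' fccStacking 1 (Real.sqrt (2 / 3)) = A₁ '' fccStacking 1 (Real.sqrt (2 / 3)) := htrans.symm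
  rcases skew_trichotomy_fin τ with hall | ⟨k, hk⟩ | ⟨c, hcube⟩
  · -- (A) generic offset: orientation-free `1/44`, frame `L`
    obtain ⟨C, R₀, hR₀, hmain⟩ := translate_twoSlabAdhesion_generic_exact hs₀ hcert hcertA A₁ t₁ A₂ t₂ htrans
      (fun k => generic_of_allInt τ hall hτΛ k)
    refine ⟨L, s₁, s₂, σ, σ', hσ, hσ', hsub₁, hsub₂, C, R₀, hR₀, ?_⟩
    intro h hh ρ hρ X P₁ P₂ hX hP₁X hP₂X₁ hcyl hP₁ hP₂
    have key := hmain h hh ρ hρ X P₁ P₂ hX hP₁X hP₂X₁ hcyl hP₁ hP₂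
    have hc' : 1 / 44 * Real.sqrt (1 - ⟪L e₃, e₃⟫_ℝ ^ 2) ≤ 1 / 44 := by
      obtain ⟨-, h1⟩ := hsin L; linarith only [h1]
    have := mul_le_mul_of_nonneg_right hc' (hπρ ρ)
    linarith only [key, this]
  · -- (B) a doubly skew axis: skew root AND a re-picked axis, frame `L'`
    obtain ⟨w, hw, s, hs, hws, hskew, L', hL', hrise⟩ := exists_skewRoot_of_axis_sine τ k hk A₁
    have hs2 : 0 < Real.sqrt 2 := by positivity
    have h0 : 0 ≤ Real.sqrt (1 - ⟪L' e₃, e₃⟫_ℝ ^ 2) / Real.sqrt 2 := by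
      obtain ⟨h0', -⟩ := hsin L'; positivity
    obtain ⟨C, R₀, hR₀, hmain⟩ := translate_twoSlabAdhesion_exact hs₀ hcert hcertA A₁ t₁ A₂ t₂ htrans hw
      (le_trans h0 hrise) hs hws hskew
    refine ⟨L', t₁, t₂, constHagg, constHagg, isHaggSeq_const, isHaggSeq_const,
      movedFcc_subset_frame_of_image_eq A₁ L' t₁ hL'.symm,
      movedFcc_subset_frame_of_image_eq A₂ L' t₂ (hΛ₂.trans hL'.symm), C, R₀, hR₀, ?_⟩
    intro h hh ρ hρ X P₁ P₂ hX hP₁X hP₂X₁ hcyl hP₁ hP₂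
    have key := hmain h hh ρ hρ X P₁ P₂ hX hP₁X hP₂X₁ hcyl hP₁ hP₂
    have hc' : 1 / 44 * Real.sqrt (1 - ⟪L' e₃, e₃⟫_ℝ ^ 2) ≤ Real.sqrt 2 * (A₁ w) 2 / 44 := by
      have h1 : Real.sqrt (1 - ⟪L' e₃, e₃⟫_ℝ ^ 2) ≤ Real.sqrt 2 * (A₁ w) 2 := by
        have := mul_le_mul_of_nonneg_left hrise hs2.le
        rw [mul_div_cancel₀ _ hs2.ne'] at this
        exact this
      linarith only [h1]
    have := mul_le_mul_of_nonneg_right hc' (hπρ ρ)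
    linarith only [key, this]
  · -- (C) a skew `{111}` plane: the defender's frame `L' = A₁ ∘ G`
    obtain ⟨L', hL', hskew⟩ := exists_skewFrame_of_cube A₁ τ c hcube
    have hsub₁' := movedFcc_subset_frame_of_image_eq A₁ L' t₁ hL'.symm
    have hsub₂' := movedFcc_subset_frame_of_image_eq A₂ L' t₂ (hΛ₂.trans hL'.symm)
    obtain ⟨C, R₀, hR₀, hmain⟩ := coaxialTwoSlabAdhesion_trans_skew_exact hs₀ hcert hcertA A₁ t₁ A₂ t₂ L' t₁
      constHagg isHaggSeq_const hsub₁' htrans hskew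
    refine ⟨L', t₁, t₂, constHagg, constHagg, isHaggSeq_const, isHaggSeq_const, hsub₁', hsub₂', C, R₀, hR₀, ?_⟩
    intro h hh ρ hρ X P₁ P₂ hX hP₁X hP₂X₁ hcyl hP₁ hP₂
    have key := hmain h hh ρ hρ X P₁ P₂ hX hP₁X hP₂X₁ hcyl hP₁ hP₂
    have hc' : 1 / 44 * Real.sqrt (1 - ⟪L' e₃, e₃⟫_ℝ ^ 2) ≤
        Real.sqrt 6 / 88 * Real.sqrt (1 - ⟪L' e₃, e₃⟫_ℝ ^ 2) := by
      obtain ⟨h0', -⟩ := hsin L'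
      have h6 : (2 : ℝ) ≤ Real.sqrt 6 := by
        rw [show (2 : ℝ) = Real.sqrt (2 ^ 2) by rw [Real.sqrt_sq (by norm_num)]]
        exact Real.sqrt_le_sqrt (by norm_num)
      nlinarith [h0', h6]
    have := mul_le_mul_of_nonneg_right hc' (hπρ ρ)
    linarith only [key, this]

open scoped Classical in
/-- **THE UNION THEOREM OF BRANCH F at `22` ends per payer: `CoaxialTwoSlabAdhesion` verbatim with `½ ↦ 1/44`**
(E1 rows by name), for EVERY co-axial pair of distinct moved fcc lattices.  See the module docstring. -/
theorem coaxialTwoSlabAdhesion_exactCharge :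
    ∀ (A₁ : EuclideanSpace ℝ (Fin 3) ≃ₗᵢ[ℝ] EuclideanSpace ℝ (Fin 3)) (t₁ : EuclideanSpace ℝ (Fin 3))
      (A₂ : EuclideanSpace ℝ (Fin 3) ≃ₗᵢ[ℝ] EuclideanSpace ℝ (Fin 3)) (t₂ : EuclideanSpace ℝ (Fin 3)),
    (∃ (L : EuclideanSpace ℝ (Fin 3) ≃ₗᵢ[ℝ] EuclideanSpace ℝ (Fin 3))
        (s₁ s₂ : EuclideanSpace ℝ (Fin 3)) (σ σ' : ℤ → ℤ), IsHaggSeq σ ∧ IsHaggSeq σ' ∧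
        (fun p => A₁ p + t₁) '' fccStacking 1 (Real.sqrt (2 / 3)) ⊆
          (fun p => L p + s₁) '' barlowStacking 1 (Real.sqrt (2 / 3)) σ ∧
        (fun p => A₂ p + t₂) '' fccStacking 1 (Real.sqrt (2 / 3)) ⊆
          (fun p => L p + s₂) '' barlowStacking 1 (Real.sqrt (2 / 3)) σ') →
    (fun p => A₁ p + t₁) '' fccStacking 1 (Real.sqrt (2 / 3)) ≠
      (fun p => A₂ p + t₂) '' fccStacking 1 (Real.sqrt (2 / 3)) →
    ∃ (L : EuclideanSpace ℝ (Fin 3) ≃ₗᵢ[ℝ] EuclideanSpace ℝ (Fin 3))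
        (s₁ s₂ : EuclideanSpace ℝ (Fin 3)) (σ σ' : ℤ → ℤ), IsHaggSeq σ ∧ IsHaggSeq σ' ∧
        (fun p => A₁ p + t₁) '' fccStacking 1 (Real.sqrt (2 / 3)) ⊆
          (fun p => L p + s₁) '' barlowStacking 1 (Real.sqrt (2 / 3)) σ ∧
        (fun p => A₂ p + t₂) '' fccStacking 1 (Real.sqrt (2 / 3)) ⊆
          (fun p => L p + s₂) '' barlowStacking 1 (Real.sqrt (2 / 3)) σ' ∧
    ∃ C R₀ : ℝ, 1 ≤ R₀ ∧ ∀ h : ℝ, 0 ≤ h → ∀ ρ : ℝ, R₀ ≤ ρ →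
      ∀ X P₁ P₂ : Finset (EuclideanSpace ℝ (Fin 3)),
      (∀ p ∈ X, ∀ q ∈ X, p ≠ q → 1 ≤ dist p q) → P₁ ⊆ X → P₂ ⊆ X \ P₁ →
      (∀ p ∈ X, -(2 * R₀) ≤ p 2 ∧ p 2 ≤ h + 2 * R₀ ∧ p 0 ^ 2 + p 1 ^ 2 ≤ ρ ^ 2) →
      (∀ p, p ∈ P₁ ↔ (p ∈ (fun q => A₁ q + t₁) '' fccStacking 1 (Real.sqrt (2 / 3)) ∧
        -(2 * R₀) ≤ p 2 ∧ p 2 ≤ -R₀ ∧ p 0 ^ 2 + p 1 ^ 2 ≤ ρ ^ 2)) →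
      (∀ p, p ∈ P₂ ↔ (p ∈ (fun q => A₂ q + t₂) '' fccStacking 1 (Real.sqrt (2 / 3)) ∧
        h + R₀ ≤ p 2 ∧ p 2 ≤ h + 2 * R₀ ∧ p 0 ^ 2 + p 1 ^ 2 ≤ ρ ^ 2)) →
      ((((P₁ ×ˢ (X \ P₁)).filter fun pq => dist pq.1 pq.2 = 1).card : ℕ) : ℝ) +
        ((((P₂ ×ˢ ((X \ P₁) \ P₂)).filter fun pq => dist pq.1 pq.2 = 1).card : ℕ) : ℝ) ≤
        contactDeficiency ((X \ P₁) \ P₂) +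
          (Real.sqrt 2 / 4 * ∑ᶠ w ∈ {w ∈ fccStacking 1 (Real.sqrt (2 / 3)) | ‖w‖ = 1},
              |⟪w, A₁.symm (EuclideanSpace.single (2 : Fin 3) (1 : ℝ))⟫_ℝ| +
            Real.sqrt 2 / 4 * ∑ᶠ w ∈ {w ∈ fccStacking 1 (Real.sqrt (2 / 3)) | ‖w‖ = 1},
              |⟪w, A₂.symm (EuclideanSpace.single (2 : Fin 3) (1 : ℝ))⟫_ℝ| -
            (1 / 44 : ℝ) * Real.sqrt (1 - ⟪L (EuclideanSpace.single (2 : Fin 3) (1 : ℝ)),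
              (EuclideanSpace.single (2 : Fin 3) (1 : ℝ))⟫_ℝ ^ 2)) * Real.pi * ρ ^ 2 +
          C * (1 + h) * ρ := by
  intro A₁ t₁ A₂ t₂ hcoax hne
  obtain ⟨L, s₁, s₂, σ, σ', hσ, hσ', hsub₁, hsub₂⟩ := hcoax
  by_cases htrans : A₁ '' fccStacking 1 (Real.sqrt (2 / 3)) = A₂ '' fccStacking 1 (Real.sqrt (2 / 3))
  · exact coaxialTwoSlabAdhesion_translate_exact hs₀ hcert hcertA A₁ t₁ A₂ t₂ L s₁ s₂ σ σ' hσ hσ' hsub₁ hsub₂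
      htrans hne
  · -- twin pair: 19481-p1's exact twin law, frame `L`
    obtain ⟨C, R₀, hR₀, hmain⟩ := coaxialTwoSlabAdhesion_general_twin_exact hs₀ hcert hcertA A₁ t₁ A₂ t₂ L s₁ s₂
      σ σ' hσ hσ' hsub₁ hsub₂ htrans
    refine ⟨L, s₁, s₂, σ, σ', hσ, hσ', hsub₁, hsub₂, C, R₀, hR₀, ?_⟩
    intro h hh ρ hρ X P₁ P₂ hX hP₁X hP₂X₁ hcyl hP₁ hP₂
    have key := hmain h hh ρ hρ X P₁ P₂ hX hP₁X hP₂X₁ hcyl hP₁ hP₂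
    set e₃ : EuclideanSpace ℝ (Fin 3) := EuclideanSpace.single (2 : Fin 3) (1 : ℝ) with he₃
    have hc' : 1 / 44 * Real.sqrt (1 - ⟪L e₃, e₃⟫_ℝ ^ 2) ≤
        Real.sqrt 6 / 88 * Real.sqrt (1 - ⟪L e₃, e₃⟫_ℝ ^ 2) := by
      have h0 : 0 ≤ Real.sqrt (1 - ⟪L e₃, e₃⟫_ℝ ^ 2) := Real.sqrt_nonneg _
      have h6 : (2 : ℝ) ≤ Real.sqrt 6 := by
        rw [show (2 : ℝ) = Real.sqrt (2 ^ 2) by rw [Real.sqrt_sq (by norm_num)]]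
        exact Real.sqrt_le_sqrt (by norm_num)
      nlinarith [h0, h6]
    have hπρ : 0 ≤ Real.pi * ρ ^ 2 := by positivity
    have := mul_le_mul_of_nonneg_right hc' hπρ
    linarith only [key, this]

end Exact

end Summit.Ventures.Crystal3D.Theorems

end
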